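import Literature.Computability.AlgebraicComplexity.AsymptoticSpectrum
import Literature.Computability.AlgebraicComplexity.FlatteningBound
import Mathlib.LinearAlgebra.Matrix.Rank
import HarnessLib

/-!
# The symmetric small Coppersmith–Winograd variant `cw'_2` and its rank-`4` decomposition (Alman–Li 2026, §7.1; Coppersmith–Winograd 1990, §11)

Topic `Literature/Computability/AlgebraicComplexity` (family `MatrixMultiplication`). Sources, read
first-hand: J. Alman, B. Li, *Asymptotic Rank Speedup Theorems, Revisited*, arXiv:2605.21738 (2026),
§7.1, the paragraph before Cor. 7.2 (held text `paper:arxiv-2605.21738`, p0017 L124–140): "the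
following variant of the `cw_2` tensor, which first appears in [CW90], is equally useful from the
perspective of the laser method: `cw'_2 ≔ x₁y₂z₃ + x₁y₃z₂ + x₂y₁z₃ + x₂y₃z₁ + x₃y₁z₂ + x₃y₂z₁`. In
particular, if one could prove `R̃(cw'_2) = 3`, then it would follow that `ω = 2`. Currently, the best
known upper bound is `R(cw'_2) = 4` (over fields of characteristic `≠ 2`), via
`cw'_2 = ¼[(x₁+x₂+x₃)(y₁+y₂+y₃)(z₁+z₂+z₃) + (−x₁+x₂−x₃)(−y₁+y₂−y₃)(−z₁+z₂−z₃)
 + (x₁−x₂−x₃)(y₁−y₂−y₃)(z₁−z₂−z₃) + (−x₁−x₂+x₃)(−y₁−y₂+y₃)(−z₁−z₂+z₃)]`"; and D. Coppersmith,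
S. Winograd, *Matrix multiplication via arithmetic progressions*, J. Symbolic Comput. 9 (1990), §11
(held text `paper:doi-10-1016-s0747-7171-08-80013-2`, p0027 L24–29: the trilinear form
`x₀y₁z₂ + x₀y₂z₁ + x₁y₀z₂ + x₂y₀z₁ + x₁y₂z₀ + x₂y₁z₀`, "this form has border rank 4").

## What is formalised (everything PROVED; one definition with a body)

* `cwPrimeTensor K : Fin 3 → Fin 3 → Fin 3 → K` — the tensor `cw'_2` (entry `1` at the six triples
  of pairwise distinct indices, `0` elsewhere), with `cwPrimeTensor_apply` and its cyclic symmetry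
  `rotate_cwPrimeTensor` (used for the three directions of Strassen calculus).
* `AlmanLi2026.cwPrimeTensor_eq_sum_signs` — the printed rank-`4` identity, over any field with
  `2 ≠ 0`, written with the sign table `cwPrimeSigns` of the four linear forms (columns
  `(1,1,1), (−1,1,−1), (1,−1,−1), (−1,−1,1)`): `cw'_2(i,j,k) = ∑_l ε_{il} ε_{jl} (ε_{kl}/4)`.
* `AlmanLi2026.cwPrimeTensor_functional_rank_le_two` — the input of the one-slice speedup theorems
  for this decomposition (the analogue of Lemma 7.1 for `cw'_2`, implicit in the proof of Cor. 7.2):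
  with the nonzero scalars `c' = (1, 1, −1, −1)` the matrix `∑_l c'_l ε_{·l} ε_{·l}ᵀ = 4(E₁₃ + E₃₁)`
  has rank `≤ 2`.  (Any `c'` with `∑ 1/c'_l = 0` works, by Cauchy–Binet.)
* `AlmanLi2026.cwPrimeTensor_rankData` — the three items bundled as the hypothesis package of the
  tree's `AlmanLi2026.thm61_rankDecomposition` / `thm62_rankDecomposition` (`r = 4`, `s = 2`), and
  `AlmanLi2026.tensorRank_cwPrimeTensor_le_four` — `R(cw'_2) ≤ 4` (the printed "`= 4`" is recorded as
  the upper bound it asserts; the lower bound `R(cw'_2) ≥ R̲(cw'_2) = 4` of [CW90, §11] is not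
  formalised here).

Cor. 7.2 itself (`R̃(cw'_2) ≤ γ'_2`, char `≠ 2`) is assembled in `AlmanLi2026CwPrimeBound` from this
data by the `λ`-free Thm. 6.2 (`AlmanLi2026IteratedFreeLunch`) and the §7.1 Strassen calculus
(`AlmanLi2026IteratedSpectrumBound`, `AlmanLi2026GammaPrimeCertificate`). No named facts.

## References

* J. Alman, B. Li, *Asymptotic Rank Speedup Theorems, Revisited*, arXiv:2605.21738 (2026), §7.1
  (p0017 L124–140), Cor. 7.2 (p0018 L1–3). [AlmanLi2026]
* D. Coppersmith, S. Winograd, *Matrix multiplication via arithmetic progressions*, J. Symbolic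
  Comput. 9 (1990) 251–280, §11. [CoppersmithWinograd1990]
-/

noncomputable section

open scoped BigOperators Matrix

namespace Literature.Computability.AlgebraicComplexity

universe u

variable {K : Type u}

section Def

variable (K) [CommSemiring K]

/-- **The symmetric variant `cw'_2` of the small Coppersmith–Winograd tensor**:
`cw'_2 = x₁y₂z₃ + x₁y₃z₂ + x₂y₁z₃ + x₂y₃z₁ + x₃y₁z₂ + x₃y₂z₁ ∈ (K³)^{⊗3}` — entry `1` at the
triples of pairwise distinct indices and `0` elsewhere (Coppersmith–Winograd 1990, §11:
`x₀y₁z₂ + x₀y₂z₁ + x₁y₀z₂ + x₂y₀z₁ + x₁y₂z₀ + x₂y₁z₀`).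
[cite: AlmanLi2026, §7.1 (display before Cor. 7.2)] [cite: CoppersmithWinograd1990, §11] -/
def cwPrimeTensor : Fin 3 → Fin 3 → Fin 3 → K :=
  fun i j k => if i ≠ j ∧ j ≠ k ∧ i ≠ k then 1 else 0

/-- Entries of `cw'_2`. [cite: AlmanLi2026, §7.1 (display before Cor. 7.2)] -/
theorem cwPrimeTensor_apply (i j k : Fin 3) :
    cwPrimeTensor K i j k = if i ≠ j ∧ j ≠ k ∧ i ≠ k then 1 else 0 := rfl

/-- `cw'_2` is invariant under the cyclic rotation of its three factors. [cite: AlmanLi2026, §7.1 (display before Cor. 7.2)] -/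
theorem rotate_cwPrimeTensor : rotate (cwPrimeTensor K) = cwPrimeTensor K := by
  funext j k i
  rw [rotate_apply, cwPrimeTensor_apply, cwPrimeTensor_apply]
  exact if_congr ⟨fun ⟨h₁, h₂, h₃⟩ => ⟨h₂, Ne.symm h₃, Ne.symm h₁⟩,
    fun ⟨h₁, h₂, h₃⟩ => ⟨Ne.symm h₃, h₁, Ne.symm h₂⟩⟩ rfl rfl

end Def

namespace AlmanLi2026

section Signs

variable (K) [CommRing K]

/-- The sign table of the four linear forms of the printed rank-`4` expression for `cw'_2`
(columns `l = 0,1,2,3`: `x₁+x₂+x₃`, `−x₁+x₂−x₃`, `x₁−x₂−x₃`, `−x₁−x₂+x₃`; rows = coordinates).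
[cite: AlmanLi2026, §7.1 (display before Cor. 7.2)] -/
def cwPrimeSigns : Fin 3 → Fin 4 → K :=
  fun i l => !![(1 : K), -1, 1, -1; 1, 1, -1, -1; 1, -1, -1, 1] i l

/-- Entries of the sign table. [cite: AlmanLi2026, §7.1 (display before Cor. 7.2)] -/
theorem cwPrimeSigns_apply (i : Fin 3) (l : Fin 4) :
    cwPrimeSigns K i l = !![(1 : K), -1, 1, -1; 1, 1, -1, -1; 1, -1, -1, 1] i l := rfl

/-- The cubic moments of the sign table: `∑_l ε_{il} ε_{jl} ε_{kl}` is `4` at pairwise distinct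
`(i,j,k)` and `0` otherwise (a ring identity, no characteristic hypothesis). [cite: AlmanLi2026, §7.1 (display before Cor. 7.2)] -/
theorem sum_cwPrimeSigns_mul_mul (i j k : Fin 3) :
    ∑ l, cwPrimeSigns K i l * cwPrimeSigns K j l * cwPrimeSigns K k l =
      if i ≠ j ∧ j ≠ k ∧ i ≠ k then 4 else 0 := by
  fin_cases i <;> fin_cases j <;> fin_cases k <;>
    simp [Fin.sum_univ_four, cwPrimeSigns_apply] <;> norm_num

end Signs

section Field

variable (K) [Field K]

/-- **The printed rank-`4` identity for `cw'_2`** over a field of characteristic `≠ 2`: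
`cw'_2(i,j,k) = ∑_{l<4} ε_{il} · ε_{jl} · (ε_{kl}/4)`, i.e.
`cw'_2 = ¼ ∑_l (∑ᵢ ε_{il} xᵢ)(∑ⱼ ε_{jl} yⱼ)(∑ₖ ε_{kl} zₖ)`.
[cite: AlmanLi2026, §7.1 (display before Cor. 7.2: "R(cw'_2) = 4 over fields of characteristic ≠ 2")] -/
theorem cwPrimeTensor_eq_sum_signs (h2 : (2 : K) ≠ 0) (i j k : Fin 3) :
    cwPrimeTensor K i j k =
      ∑ l, cwPrimeSigns K i l * cwPrimeSigns K j l * (cwPrimeSigns K k l * (4 : K)⁻¹) := by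
  have h4 : (4 : K) ≠ 0 := by
    have : (4 : K) = 2 * 2 := by norm_num
    rw [this]
    exact mul_ne_zero h2 h2
  have hs : ∑ l, cwPrimeSigns K i l * cwPrimeSigns K j l * (cwPrimeSigns K k l * (4 : K)⁻¹) =
      (∑ l, cwPrimeSigns K i l * cwPrimeSigns K j l * cwPrimeSigns K k l) * (4 : K)⁻¹ := by
    rw [Finset.sum_mul]
    exact Finset.sum_congr rfl fun l _ => by ring
  rw [hs, sum_cwPrimeSigns_mul_mul, cwPrimeTensor_apply]
  split_ifs
  · rw [mul_inv_cancel₀ h4]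
  · rw [zero_mul]

/-- **The functional for `cw'_2`'s rank-`4` decomposition** (the hypothesis of Thm. 6.1 / 6.2 used for
Cor. 7.2): with `c' = (1, 1, −1, −1)` (all nonzero), `M = ∑_l c'_l ε_{·l} ε_{·l}ᵀ = 4(E₁₃ + E₃₁)` has
rank at most `2`.  Proof: `M = P·Q` through `K²`. [cite: AlmanLi2026, Cor. 7.2 (proof via Thm. 6.2, cf. Lemma 7.1)] -/
theorem cwPrimeTensor_functional_rank_le_two :
    (Matrix.of fun i j : Fin 3 =>
      ∑ l, cwPrimeSigns K i l * cwPrimeSigns K j l * ![(1 : K), 1, -1, -1] l).rank ≤ 2 := by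
  have hM : (Matrix.of fun i j : Fin 3 =>
      ∑ l, cwPrimeSigns K i l * cwPrimeSigns K j l * ![(1 : K), 1, -1, -1] l) =
      !![(4 : K), 0; 0, 0; 0, 4] * !![(0 : K), 0, 1; 1, 0, 0] := by
    ext i j
    fin_cases i <;> fin_cases j <;>
      simp [Fin.sum_univ_four, cwPrimeSigns_apply, Matrix.mul_apply, Fin.sum_univ_two] <;> norm_num
  rw [hM]
  refine (Matrix.rank_mul_le_left _ _).trans ?_
  have h := Matrix.rank_le_card_width (!![(4 : K), 0; 0, 0; 0, 4])
  simpa using h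

/-- **Rank data of `cw'_2` for the speedup theorems** (char `≠ 2`): matrices `A = B = ε`,
`C₀ = ε/4`, nonzero scalars `c'` with `rank (∑_l c'_l a_l b_lᵀ) ≤ 2` — exactly the hypotheses
`hT`, `hc'`, `hM` of the tree's `AlmanLi2026.thm61_rankDecomposition` / `thm62_rankDecomposition`
with `r = 4`, `s = 2` (so `t = r + s − 2·3 = 0` for `n = 1`; the Kronecker powers give
`t = 4^n + 2^n − 2·3^n`). [cite: AlmanLi2026, Cor. 7.2 (proof)] -/
theorem cwPrimeTensor_rankData (h2 : (2 : K) ≠ 0) :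
    ∃ (A C₀ : Fin 3 → Fin 4 → K) (c' : Fin 4 → K),
      (∀ i j k, cwPrimeTensor K i j k = ∑ l, A i l * A j l * C₀ k l) ∧ (∀ l, c' l ≠ 0) ∧
      (Matrix.of fun i j : Fin 3 => ∑ l, A i l * A j l * c' l).rank ≤ 2 := by
  refine ⟨cwPrimeSigns K, fun k l => cwPrimeSigns K k l * (4 : K)⁻¹, ![(1 : K), 1, -1, -1],
    cwPrimeTensor_eq_sum_signs K h2, ?_, cwPrimeTensor_functional_rank_le_two K⟩
  intro l
  fin_cases l <;> simp

/-- **`R(cw'_2) ≤ 4` over fields of characteristic `≠ 2`** ("Currently, the best known upper bound is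
`R(cw'_2) = 4` (over fields of characteristic `≠ 2`)"; the matching lower bound — the border rank is
`4`, Coppersmith–Winograd 1990 §11 — is not formalised here).
[cite: AlmanLi2026, §7.1 (display before Cor. 7.2)] [cite: CoppersmithWinograd1990, §11] -/
theorem tensorRank_cwPrimeTensor_le_four (h2 : (2 : K) ≠ 0) : tensorRank (cwPrimeTensor K) ≤ 4 := by
  refine tensorRank_le_of_eq_sum (fun l i => cwPrimeSigns K i l) (fun l j => cwPrimeSigns K j l)
    (fun l k => cwPrimeSigns K k l * (4 : K)⁻¹) ?_
  funext i j k
  rw [cwPrimeTensor_eq_sum_signs K h2, Finset.sum_apply, Finset.sum_apply, Finset.sum_apply]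
  exact Finset.sum_congr rfl fun l _ => by rw [triad_apply]

end Field

end AlmanLi2026

end Literature.Computability.AlgebraicComplexity
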